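import Literature.AlgebraicGeometry.Resolution.VertexProjectionRingHomSmooth
import Mathlib.RingTheory.LocalRing.ResidueField.Fiber
import Mathlib.RingTheory.PolynomialAlgebra
import Mathlib.RingTheory.KrullDimension.Polynomial
import Mathlib.Topology.KrullDimension
import HarnessLib

/-!
# The fibres of the projection `Bl_p ℙ^{d+1} → ℙ^d` on the charts are affine lines

Topic: `Literature/AlgebraicGeometry/Resolution`. Commutative algebra for the construction of
de Jong 1996, proof of Lemma 4.11 (p. 68) — the fibres of the projection `q = pr_p : P̃ → ℙ^d`
from the blow-up of `ℙ^{d+1}` in the vertex `p` ("every fibre `q⁻¹(ℓ)` (the line `ℓ`) is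
irreducible … of dimension `≤ 1`", the fields `irreducibleSpace_fiber` and
`topologicalKrullDim_fiber_le_one` of `DeJong1996.PointBlowupProjection`). On the charts `q` is
`Spec` of a ring map `ρ : R → S` making `S` a polynomial ring in one variable over `R`
(`S ≅ R[T]` with `ρ = C`): the linear projection `(k[y]_{(yᵢ)})₀ → (k[x]_{(xᵢ)})₀` off the vertex
(`VertexProjectionRingHomSmooth.lean`) and `(k[y]_{(yᵢ)})₀ → k[X][I/Xᵢ]` on the vertex charts
(`PointBlowupAlgebraCharts.lean`, `PointBlowupProjectionRingHom.lean`). PROVED here: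

* generic: for `ρ : R → S`, `e : S ≅ R[T]` with `e ∘ ρ = C`, and a prime `𝔭` of `R`, the fibre ring
  `κ(𝔭) ⊗_R S ≅ κ(𝔭)[T]` (`fiberEquivPolynomial`), so the fibre of `Spec S → Spec R` over `𝔭` —
  the subspace `comap ρ ⁻¹' {𝔭}` of `Spec S` (Mathlib `PrimeSpectrum.preimageHomeomorphFiber`) — is
  **irreducible, non-empty and of topological Krull dimension `1`**
  (`isIrreducible_preimage_comap_singleton`, `topologicalKrullDim_preimage_comap_singleton`);
* the two instances: `DeJong1996.awayPolyEquiv d k i : (k[x]_{(xᵢ)})₀ ≅ ((k[y]_{(yᵢ)})₀)[T]` with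
  `awayPolyEquiv ∘ vertexProjectionRingHom = C`, and
  `PointBlowup.chartPolyEquiv d k i : k[X][I/Xᵢ] ≅ ((k[y]_{(yᵢ)})₀)[T]` with
  `chartPolyEquiv ∘ projRingHom = C`; hence the fibres of `pr_p` on `D₊(xᵢ)` and of `q` on the
  vertex charts are irreducible of dimension `1`.

No named facts; [folklore] throughout.

## Sources

* A. J. de Jong, *Smoothness, semi-stability and alterations*, Publ. Math. IHÉS 83 (1996),
  proof of Lemma 4.11, p. 68. [DeJong1996]
* D. Eisenbud, J. Harris, *3264 and All That* (2016), Prop. 9.11 (the blow-up of `ℙⁿ` in a point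
  is a `ℙ¹`-bundle over `ℙ^{n-1}`). [EisenbudHarris2016]
-/

noncomputable section

open HomogeneousLocalization Polynomial TensorProduct

attribute [local instance] MvPolynomial.gradedAlgebra
  Literature.AlgebraicGeometry.Motives.ProjBaseChange.algebraBase
  Literature.AlgebraicGeometry.Motives.ProjBaseChange.isScalarTower_localization

namespace Literature.AlgebraicGeometry.Resolution

universe u

/-! ## Generic: the fibres of `Spec` of a polynomial algebra in one variable -/

section Generic

variable {R S : Type u} [CommRing R] [CommRing S] (ρ : R →+* S) (e : S ≃+* R[X])
  (he : e.toRingHom.comp ρ = Polynomial.C)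

/-- `e` as an isomorphism of `R`-algebras, `S` an `R`-algebra through `ρ`. [folklore] -/
def algEquivPolynomialOfComp : letI := ρ.toAlgebra; S ≃ₐ[R] R[X] :=
  letI := ρ.toAlgebra
  AlgEquiv.ofRingEquiv (f := e) fun r => by
    change e (ρ r) = Polynomial.C r
    exact congrArg (fun φ : R →+* R[X] => φ r) he

include he in
/-- **The fibre ring is a polynomial ring over the residue field**: `κ(𝔭) ⊗_R S ≅ κ(𝔭)[T]` when
`S ≅ R[T]` over `R`. [folklore] -/
def fiberEquivPolynomial (p : Ideal R) [p.IsPrime] :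
    letI := ρ.toAlgebra; p.Fiber S ≃+* (p.ResidueField)[X] :=
  letI := ρ.toAlgebra
  ((Algebra.TensorProduct.congr (AlgEquiv.refl : p.ResidueField ≃ₐ[R] p.ResidueField)
    (algEquivPolynomialOfComp ρ e he)).trans (polyEquivTensor R p.ResidueField).symm).toRingEquiv

include he in
/-- The spectrum of the fibre ring is irreducible (`κ(𝔭)[T]` is a domain). [folklore] -/
theorem irreducibleSpace_primeSpectrum_fiber (p : Ideal R) [p.IsPrime] :
    letI := ρ.toAlgebra; IrreducibleSpace (PrimeSpectrum (p.Fiber S)) := by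
  letI := ρ.toAlgebra
  let h := PrimeSpectrum.homeomorphOfRingEquiv (fiberEquivPolynomial ρ e he p)
  have huniv : IsIrreducible (Set.univ : Set (PrimeSpectrum (p.Fiber S))) := by
    have := (IrreducibleSpace.isIrreducible_univ (PrimeSpectrum (p.ResidueField)[X])).image h.symm
      h.symm.continuous.continuousOn
    rwa [Set.image_univ, h.symm.range_coe] at this
  exact (irreducibleSpace_def _).mpr huniv

include he in
/-- The spectrum of the fibre ring has dimension `1` (`dim κ(𝔭)[T] = 1`). [folklore] -/
theorem topologicalKrullDim_primeSpectrum_fiber (p : Ideal R) [p.IsPrime] :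
    letI := ρ.toAlgebra; topologicalKrullDim (PrimeSpectrum (p.Fiber S)) = 1 := by
  letI := ρ.toAlgebra
  let h := PrimeSpectrum.homeomorphOfRingEquiv (fiberEquivPolynomial ρ e he p)
  rw [IsHomeomorph.topologicalKrullDim_eq h h.isHomeomorph, PrimeSpectrum.topologicalKrullDim_eq_ringKrullDim,
    Polynomial.ringKrullDim_of_isNoetherianRing, ringKrullDim_eq_zero_of_field]
  rfl

include he in
/-- **The fibre of `Spec S → Spec R` over `𝔭` is irreducible** (as a subspace of `Spec S`).
[folklore] -/
theorem isIrreducible_preimage_comap_singleton (p : PrimeSpectrum R) :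
    IsIrreducible (PrimeSpectrum.comap ρ ⁻¹' {p}) := by
  letI := ρ.toAlgebra
  haveI := irreducibleSpace_primeSpectrum_fiber ρ e he p.asIdeal
  let h := PrimeSpectrum.preimageHomeomorphFiber R S p
  have huniv : IsIrreducible (Set.univ : Set (PrimeSpectrum.comap (algebraMap R S) ⁻¹' {p})) := by
    have := (IrreducibleSpace.isIrreducible_univ (PrimeSpectrum (p.asIdeal.Fiber S))).image h.symm
      h.symm.continuous.continuousOn
    rwa [Set.image_univ, h.symm.range_coe] at this
  have := huniv.image (Subtype.val : PrimeSpectrum.comap (algebraMap R S) ⁻¹' {p} → PrimeSpectrum S)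
    continuous_subtype_val.continuousOn
  rwa [Set.image_univ, Subtype.range_coe] at this

include he in
/-- **The fibre of `Spec S → Spec R` over `𝔭` has topological Krull dimension `1`.** [folklore] -/
theorem topologicalKrullDim_preimage_comap_singleton (p : PrimeSpectrum R) :
    topologicalKrullDim (PrimeSpectrum.comap ρ ⁻¹' {p}) = 1 := by
  letI := ρ.toAlgebra
  let h := PrimeSpectrum.preimageHomeomorphFiber R S p
  change topologicalKrullDim (PrimeSpectrum.comap (algebraMap R S) ⁻¹' {p}) = 1
  rw [IsHomeomorph.topologicalKrullDim_eq h h.isHomeomorph]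
  exact topologicalKrullDim_primeSpectrum_fiber ρ e he p.asIdeal

include he in
/-- The fibre is non-empty. [folklore] -/
theorem preimage_comap_singleton_nonempty (p : PrimeSpectrum R) :
    (PrimeSpectrum.comap ρ ⁻¹' {p}).Nonempty :=
  (isIrreducible_preimage_comap_singleton ρ e he p).nonempty

end Generic

/-! ## The chart rings as polynomial rings over `(k[y]_{(yᵢ)})₀` -/

open Literature.AlgebraicGeometry.Motives.Segre (grading cst frac X_mem)

namespace DeJong1996

variable (d : ℕ) (k : Type u) [Field k] (i : Fin (d + 1))

/-- **`(k[x]_{(xᵢ)})₀ ≅ ((k[y]_{(yᵢ)})₀)[T]`**, `T = x_{d+1}/xᵢ`, compatibly with the projection from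
the vertex `y_a/yᵢ ↦ x_a/xᵢ` (dehomogenise, `basePolyEquiv`, homogenise the coefficients). [folklore] -/
def awayPolyEquiv : Away (grading (Fin (d + 1 + 1)) k) (MvPolynomial.X (Fin.castSucc i)) ≃+*
    (Away (grading (Fin (d + 1)) k) (MvPolynomial.X i))[X] :=
  (PointBlowup.awayBaseEquiv (d + 1) k (Fin.castSucc i)).trans
    ((basePolyEquiv d k i).trans (Polynomial.mapEquiv (PointBlowup.awayBaseEquiv d k i).symm))

/-- `awayPolyEquiv ∘ vertexProjectionRingHom = C`. [folklore] -/
theorem awayPolyEquiv_comp_vertexProjectionRingHom :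
    (awayPolyEquiv d k i).toRingHom.comp (vertexProjectionRingHom d k i) = Polynomial.C := by
  refine RingHom.ext fun a => ?_
  rw [RingHom.comp_apply, vertexProjectionRingHom_eq, RingEquiv.toRingHom_eq_coe, RingEquiv.coe_toRingHom,
    awayPolyEquiv, RingEquiv.trans_apply, RingEquiv.trans_apply]
  simp only [RingHom.comp_apply, RingEquiv.toRingHom_eq_coe, RingEquiv.coe_toRingHom,
    RingEquiv.apply_symm_apply]
  have h := congrArg (fun φ : _ →+* _ => φ (PointBlowup.awayBaseEquiv d k i a)) (basePolyEquiv_comp_baseIncl d k i)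
  simp only [RingHom.comp_apply, RingEquiv.toRingHom_eq_coe, RingEquiv.coe_toRingHom] at h
  rw [h, Polynomial.mapEquiv_apply, Polynomial.map_C, RingEquiv.coe_toRingHom, RingEquiv.symm_apply_apply]

/-- The fibre of the projection from the vertex over a point of `D₊(yᵢ)`, read on the chart
`D₊(xᵢ)`, is irreducible of dimension `1` (an affine line). [cite: DeJong1996, Lemma 4.11 (proof), p. 68] -/
theorem isIrreducible_fibre_vertexProjectionRingHom (p : PrimeSpectrum (Away (grading (Fin (d + 1)) k) (MvPolynomial.X i))) :
    IsIrreducible (PrimeSpectrum.comap (vertexProjectionRingHom d k i) ⁻¹' {p}) ∧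
      topologicalKrullDim (PrimeSpectrum.comap (vertexProjectionRingHom d k i) ⁻¹' {p}) = 1 :=
  ⟨isIrreducible_preimage_comap_singleton _ _ (awayPolyEquiv_comp_vertexProjectionRingHom d k i) p,
    topologicalKrullDim_preimage_comap_singleton _ _ (awayPolyEquiv_comp_vertexProjectionRingHom d k i) p⟩

end DeJong1996

namespace PointBlowup

variable (n : ℕ) (k : Type u) [Field k] (i : Fin (n + 1))

/-- `polyEquiv⁻¹ (βᵢ b) = C b`. [folklore] -/
theorem polyEquiv_symm_baseHom (b : Base n k i) :
    (polyEquiv n k i).symm (baseHom n k i b) = MvPolynomial.C b := by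
  apply (polyEquiv n k i).injective
  rw [RingEquiv.apply_symm_apply, polyEquiv_apply, polyHom_C]

/-- **`k[X][I/Xᵢ] ≅ ((k[y]_{(yᵢ)})₀)[T]`**, `T = Xᵢ`, compatibly with `projRingHom`
(`polyEquiv⁻¹`, `MvPolynomial.uniqueAlgEquiv`, homogenise the coefficients). [folklore] -/
def chartPolyEquiv : Chart n k i ≃+* (Away (grading (Fin (n + 1)) k) (MvPolynomial.X i))[X] :=
  (polyEquiv n k i).symm.trans ((MvPolynomial.uniqueAlgEquiv (Base n k i) Unit).toRingEquiv.trans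
    (Polynomial.mapEquiv (awayBaseEquiv n k i).symm))

/-- `chartPolyEquiv ∘ projRingHom = C`. [folklore] -/
theorem chartPolyEquiv_comp_projRingHom :
    (chartPolyEquiv n k i).toRingHom.comp (projRingHom n k i) = Polynomial.C := by
  refine RingHom.ext fun a => ?_
  rw [RingHom.comp_apply, projRingHom, RingHom.comp_apply, RingEquiv.toRingHom_eq_coe,
    RingEquiv.coe_toRingHom, RingEquiv.toRingHom_eq_coe, RingEquiv.coe_toRingHom,
    AlgHom.toRingHom_eq_coe, RingHom.coe_coe, chartPolyEquiv, RingEquiv.trans_apply,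
    RingEquiv.trans_apply, polyEquiv_symm_baseHom, ← MvPolynomial.algebraMap_eq]
  change Polynomial.mapEquiv (awayBaseEquiv n k i).symm
    (MvPolynomial.uniqueAlgEquiv (Base n k i) Unit (algebraMap (Base n k i) _ (awayBaseEquiv n k i a))) = _
  rw [AlgEquiv.commutes, Polynomial.algebraMap_eq, Polynomial.mapEquiv_apply, Polynomial.map_C,
    RingEquiv.coe_toRingHom, RingEquiv.symm_apply_apply]

/-- The fibre of `q` over a point of `D₊(yᵢ)`, read on the chart `Spec k[X][I/Xᵢ]`, is irreducible
of dimension `1` (an affine line). [cite: DeJong1996, Lemma 4.11 (proof), p. 68] -/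
theorem isIrreducible_fibre_projRingHom (p : PrimeSpectrum (Away (grading (Fin (n + 1)) k) (MvPolynomial.X i))) :
    IsIrreducible (PrimeSpectrum.comap (projRingHom n k i) ⁻¹' {p}) ∧
      topologicalKrullDim (PrimeSpectrum.comap (projRingHom n k i) ⁻¹' {p}) = 1 :=
  ⟨isIrreducible_preimage_comap_singleton _ _ (chartPolyEquiv_comp_projRingHom n k i) p,
    topologicalKrullDim_preimage_comap_singleton _ _ (chartPolyEquiv_comp_projRingHom n k i) p⟩

end PointBlowup

end Literature.AlgebraicGeometry.Resolution

end
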